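import Summits.AtomisticToContinuum.BoseEinsteinCondensation.Theorems.BECRichardsonGaudinRichardsonAnchorBECDefs
import Summits.AtomisticToContinuum.BoseEinsteinCondensation.Theorems.BECRichardsonGaudinRichardsonAnchorBECPairSquareLower
import Summits.AtomisticToContinuum.BoseEinsteinCondensation.Theorems.BECRichardsonGaudinRichardsonAnchorBECCrossTermLower
import Summits.AtomisticToContinuum.BoseEinsteinCondensation.Theorems.BECRichardsonGaudinRichardsonAnchorBECBandKineticLower
import Summits.AtomisticToContinuum.BoseEinsteinCondensation.Theorems.BECRichardsonGaudinRichardsonAnchorBECCondensatePairJensen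
import Summits.AtomisticToContinuum.BoseEinsteinCondensation.Theorems.BECRichardsonGaudinRichardsonAnchorBECBandBubbleLower
import Summits.AtomisticToContinuum.BoseEinsteinCondensation.Theorems.BECGroundStateSOSPeriodicIRBoundFsumCouplingSelect
import Literature.MathematicalPhysics.QuantumManyBody.BoseGasThermodynamicLimitRuelle
import HarnessLib

/-!
# Crux `RichardsonAnchorBEC` (stmt-AtomisticToContinuum-14805), line `registered` — the condensate-penalised lower bound, core

Core (`stub_lowerBoundCore`, fixed `(n, L, M, Φ)`) of `stub_penalisedLowerBound` (sequel file): for `γ, Λ > 0` there is `ϑ > 0` (`ϑ = γJ_*/(1+γJ_*)`, `J_* = Λ/(12π³)`) such that for every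
`ε > 0`, `ρ ∈ (0,1)` and all large `N = n+2`, EVERY periodic trial state satisfies
`e_ref + ϑργ(1−ε)N ≤ E_Δ(Φ) + ϑργ·n₀(Φ)` (`Δ = 2ργ`, `e_ref = bornEnergy`). No smallness of `ρ` is needed.
Proof = assembly (`stub_lowerBoundCore`) of the landed sums of squares `stub_pairSquareLower` (`(P − sa₀²)†(P − sa₀²) ≥ 0`),
`stub_crossTermLower` (`C_k†C_k ≥ 0`, `C_k = √ε_k a_k + (w/√ε_k)a_{-k}†a₀²`), `stub_bandKineticLower`,
`stub_condensatePairJensen` (`⟨N₀(N₀−1)⟩ ≥ n₀² − n₀`) and `stub_bandBubbleLower` (`J_M ≥ Λ/(12π³)`), with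
`s = 1/(1+γJ_M)`, `ε_k = k² + ακ`, `α = D₀/(2κ)`, `D₀ = γρ/(1+γJ_M)`, `κ = Δ − λ ≥ 2D₀` (the HFB stability threshold):
`E_κ ≥ (κ − D₀)(N − n₀) + (γ/(2L³(1+γJ_M)))(n₀² − n₀)` and `E_Δ + λn₀ = E_κ + λN`.
-/

noncomputable section

namespace Summit.AtomisticToContinuum.BoseEinsteinCondensation.Cruxes.RichardsonAnchorBEC.Birth

open MeasureTheory Filter
open scoped ENNReal NNReal
open Literature.MathematicalPhysics.QuantumManyBody.BoseGas
open Summit.AtomisticToContinuum.BoseEinsteinCondensation.Theses.BECRichardsonGaudin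
open Summit.AtomisticToContinuum.BoseEinsteinCondensation.Cruxes.PeriodicIRBound.LinearPhFloorWagner.WF (normSq innerRe)



/-! ### The assembly of the lower bound from the five landed stubs -/

/-- The anchor functional unfolded (definitional): kinetic energy, shift `κ(N − n₀)`, and the pair term with
the band kernel `w = bandKernel L M`, `M = ⌊ΛL/2π⌋` (`bandKernel_eq`, `momentumBand` are `rfl`). [folklore] -/
theorem anchorE_eq (γ κ ρ : ℝ) (n : ℕ) (Λ : ℝ) (Φ : PeriodicTrialState (n + 2) (sideLength ρ (n + 2))) :
    anchorE γ κ ρ n Λ Φ = periodicEnergy 0 Φ +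
      ENNReal.ofReal κ * (((n + 2 : ℕ) : ℝ≥0∞) - condensateOccupation (n + 2) (sideLength ρ (n + 2)) Φ.ψ) +
      ENNReal.ofReal (γ / sideLength ρ (n + 2) ^ 9 * (((n + 2 : ℕ) : ℝ) * ((n + 2 : ℕ) - 1) / 2)) *
        (∫⁻ Y in cellN n (sideLength ρ (n + 2)), (‖∫ x in cell (sideLength ρ (n + 2)),
          ∫ y in cell (sideLength ρ (n + 2)),
            (starRingEnd ℂ)
                (bandKernel (sideLength ρ (n + 2)) ⌊Λ * sideLength ρ (n + 2) / (2 * Real.pi)⌋₊ x y) *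
              Φ.ψ (Matrix.vecCons x (Matrix.vecCons y Y))‖₊ : ℝ≥0∞) ^ 2) :=
  rfl

/-- Time reversal `k ↦ −k` permutes the punctured band `B_M ∖ 0`: `Σ_{B'} f(−k) = Σ_{B'} f(k)`. [folklore] -/
theorem sum_band_erase_neg {β : Type*} [AddCommMonoid β] (M : ℕ) (f : Momentum → β) :
    ∑ k ∈ (momentumBand M).erase 0, f (-k) = ∑ k ∈ (momentumBand M).erase 0, f k := by
  refine Finset.sum_equiv (Equiv.neg Momentum) (fun k => ?_) (fun k _ => rfl)
  simp only [Finset.mem_erase, Equiv.neg_apply, ne_eq, neg_eq_zero]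
  exact and_congr_right fun _ => ⟨neg_mem_momentumBand, fun h => by simpa using neg_mem_momentumBand h⟩

/-- `|2πk/L|² > 0` off the zero mode. [folklore] -/
theorem norm_waveVector_sq_pos {L : ℝ} (hL : L ≠ 0) {k : Momentum} (hk : k ≠ 0) :
    0 < ‖waveVector L k‖ ^ 2 := by
  rw [norm_waveVector_sq]
  have h : 0 < ∑ j, (k j : ℝ) ^ 2 := by
    obtain ⟨j, hj⟩ : ∃ j, k j ≠ 0 := by
      by_contra h
      exact hk (funext fun j => not_not.1 (not_exists.1 h j))
    exact Finset.sum_pos' (fun i _ => sq_nonneg _) ⟨j, Finset.mem_univ _, by positivity⟩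
  positivity

/-- The band bubble is the punctured-band sum of `1/|k|²`:
`Σ_{k ∈ B_M∖0} 1/|2πk/L|² = 2L³ J_M(L)`. [folklore] -/
theorem sum_inv_norm_waveVector_sq {L : ℝ} (hL : L ≠ 0) (M : ℕ) :
    ∑ k ∈ (momentumBand M).erase 0, 1 / ‖waveVector L k‖ ^ 2 = 2 * L ^ 3 * bandBubble L M := by
  unfold bandBubble
  rw [← mul_assoc, mul_one_div_cancel (mul_ne_zero two_ne_zero (pow_ne_zero 3 hL)), one_mul]
  refine Finset.sum_congr rfl fun k _ => ?_
  rw [norm_waveVector_sq]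
  congr 1
  ring

/-- With `M = ⌊ΛL/2π⌋` and `L ≥ 4π/Λ` one has `M ≥ 1`, `M ≥ ΛL/4π`, hence by P6
`J_M(L) ≥ M/(3π²L) ≥ Λ/(12π³) = J_*`. [folklore] -/
theorem jstar_le_bandBubble {Λ L : ℝ} (hΛ : 0 < Λ) (hL : 0 < L)
    (hLΛ : 4 * Real.pi / Λ ≤ L) :
    Λ / (12 * Real.pi ^ 3) ≤ bandBubble L ⌊Λ * L / (2 * Real.pi)⌋₊ := by
  have hπ := Real.pi_pos
  set x : ℝ := Λ * L / (2 * Real.pi) with hx_def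
  have hΛL : 4 * Real.pi ≤ Λ * L := by
    have := (div_le_iff₀ hΛ).1 hLΛ
    linarith
  have hx : 2 ≤ x := by
    rw [hx_def, le_div_iff₀ (by positivity)]
    linarith
  have hM1 : 1 ≤ ⌊x⌋₊ := Nat.le_floor (by push_cast; linarith)
  have hMx : Λ * L / (4 * Real.pi) ≤ (⌊x⌋₊ : ℝ) := by
    have h1 := Nat.lt_floor_add_one x
    have h2 : Λ * L / (4 * Real.pi) = x / 2 := by
      rw [hx_def]
      field_simp
      ring
    rw [h2]
    linarith
  have h := stub_bandBubbleLower L ⌊x⌋₊ hL hM1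
  calc Λ / (12 * Real.pi ^ 3) = Λ * L / (4 * Real.pi) / (3 * Real.pi ^ 2 * L) := by
        field_simp
        ring
    _ ≤ (⌊x⌋₊ : ℝ) / (3 * Real.pi ^ 2 * L) := div_le_div_of_nonneg_right hMx (by positivity)
    _ ≤ _ := h

/-- Pure-real bookkeeping of the band sums: the pair square (P1) scaled by `g/2`, the cross terms (P2) summed over
the punctured band with `1/ε_k ≤ 1/(ακ)` resp. `≤ 1/|k|²`, subadditivity of the positive part, and the kinetic /
occupation budgets (P3). [folklore] -/
theorem asm_real {ι : Type*} (B : Finset ι) (σ : ι → ι) (kk nk X : ι → ℝ) {s w g a p t d ακ N C : ℝ}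
    (hk : ∀ k ∈ B, 0 < kk k) (hn : ∀ k, 0 ≤ nk k) (ha : 0 ≤ a) (hακ : 0 < ακ) (hg : 0 ≤ g)
    (hw : w = g * s / 2)
    (R1 : ∑ k ∈ B, kk k * nk k ≤ t) (R2 : ∑ k ∈ B, nk k ≤ d) (R2' : ∑ k ∈ B, nk (σ k) ≤ d)
    (R3 : 2 * s * a ≤ p + s ^ 2 * a + max (-(2 * s * ∑ k ∈ B, X k)) 0)
    (R4 : ∀ k ∈ B, max (-(2 * w * X k)) 0 ≤
      (kk k + ακ) * nk k + w ^ 2 / (kk k + ακ) * (N ^ 2 * nk (σ k) + a))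
    (R7 : ∑ k ∈ B, 1 / kk k = C) :
    g * s * a ≤ g / 2 * p + t + (g * s ^ 2 / 2 + w ^ 2 * C) * a + (ακ + w ^ 2 * N ^ 2 / ακ) * d := by
  -- termwise bound of the cross terms
  have hterm : ∀ k ∈ B, max (-(2 * w * X k)) 0 ≤
      kk k * nk k + ακ * nk k + (w ^ 2 * N ^ 2 / ακ) * nk (σ k) + (w ^ 2 * a) * (1 / kk k) := by
    intro k hkB
    have hkk := hk k hkB
    have hε : 0 < kk k + ακ := by linarith
    refine (R4 k hkB).trans ?_
    have e1 : w ^ 2 / (kk k + ακ) * (N ^ 2 * nk (σ k) + a) =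
        (w ^ 2 * N ^ 2 * nk (σ k)) / (kk k + ακ) + (w ^ 2 * a) / (kk k + ακ) := by ring
    have i1 : (w ^ 2 * N ^ 2 * nk (σ k)) / (kk k + ακ) ≤ (w ^ 2 * N ^ 2 * nk (σ k)) / ακ :=
      div_le_div_of_nonneg_left (by have := hn (σ k); positivity) hακ (by linarith)
    have i2 : (w ^ 2 * a) / (kk k + ακ) ≤ (w ^ 2 * a) / kk k :=
      div_le_div_of_nonneg_left (by positivity) hkk (by linarith)
    have e2 : (w ^ 2 * N ^ 2 * nk (σ k)) / ακ = (w ^ 2 * N ^ 2 / ακ) * nk (σ k) := by ring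
    have e3 : (w ^ 2 * a) / kk k = (w ^ 2 * a) * (1 / kk k) := by ring
    linarith [e1, i1, i2, e2, e3]
  have hsum := Finset.sum_le_sum hterm
  have hexp :
      ∑ k ∈ B, (kk k * nk k + ακ * nk k + (w ^ 2 * N ^ 2 / ακ) * nk (σ k) + (w ^ 2 * a) * (1 / kk k)) =
        ∑ k ∈ B, kk k * nk k + ακ * ∑ k ∈ B, nk k + (w ^ 2 * N ^ 2 / ακ) * ∑ k ∈ B, nk (σ k) +
          (w ^ 2 * a) * ∑ k ∈ B, 1 / kk k := by
    simp only [Finset.sum_add_distrib, Finset.mul_sum]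
  rw [hexp, R7] at hsum
  -- subadditivity of the positive part
  have hsub : max (-(2 * w * ∑ k ∈ B, X k)) 0 ≤ ∑ k ∈ B, max (-(2 * w * X k)) 0 := by
    rw [Finset.mul_sum, ← Finset.sum_neg_distrib]
    exact max_le (Finset.sum_le_sum fun i _ => le_max_left _ _) (Finset.sum_nonneg fun i _ => le_max_right _ _)
  -- scale P1 by `g/2`
  have hscale : g / 2 * max (-(2 * s * ∑ k ∈ B, X k)) 0 = max (-(2 * w * ∑ k ∈ B, X k)) 0 := by
    rw [mul_max_of_nonneg _ _ (by positivity), mul_zero, hw]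
    congr 1
    ring
  have R3' := mul_le_mul_of_nonneg_left R3 (by positivity : 0 ≤ g / 2)
  rw [mul_add, mul_add, hscale] at R3'
  have hd1 : ακ * ∑ k ∈ B, nk k ≤ ακ * d := mul_le_mul_of_nonneg_left R2 hακ.le
  have hd2 : (w ^ 2 * N ^ 2 / ακ) * ∑ k ∈ B, nk (σ k) ≤ (w ^ 2 * N ^ 2 / ακ) * d :=
    mul_le_mul_of_nonneg_left R2' (by positivity)
  have ha1 : (w ^ 2 * a) * C = w ^ 2 * C * a := by ring
  nlinarith [hsum, hsub, R3', hd1, hd2, R1, ha1]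

/-- The constants of the assembly (`L³ = N/ρ`, `s(1+γJ) = 1`): `gs²/2 + 2w²L³J = gs/2`,
`ακ + w²N²/(ακ) = D₀`, `gsN = D₀`, `e_ref = (gs/2)N²`, `γ/(2L³) = g/2`. [folklore] -/
theorem asm_consts {γ L J ρ κ N s g w D₀ α : ℝ} (hγ : 0 < γ) (hL : 0 < L) (hJ : 0 ≤ J) (hρ : 0 < ρ)
    (hκ : 0 < κ) (hN : N = ρ * L ^ 3) (hs : s = 1 / (1 + γ * J)) (hg : g = γ / L ^ 3)
    (hw : w = g * s / 2) (hD₀ : D₀ = γ * ρ * s) (hα : α = D₀ / (2 * κ)) :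
    g * s ^ 2 / 2 + w ^ 2 * (2 * L ^ 3 * J) = g * s / 2 ∧
    α * κ + w ^ 2 * N ^ 2 / (α * κ) = D₀ ∧
    g * s * N = D₀ ∧
    γ * ρ * N / (2 * (1 + γ * J)) = g * s / 2 * N ^ 2 ∧
    γ / (2 * L ^ 3) = g / 2 := by
  have h1J : 0 < 1 + γ * J := by positivity
  subst hα hD₀ hw hg hs hN
  refine ⟨?_, ?_, ?_, ?_, ?_⟩
  · field_simp
  · field_simp
    ring
  · field_simp
  · field_simp
  · field_simp

/-- The final polynomial inequality: with `D₀ = 2B_cN`, `κ ≥ 2D₀`, `B_c ≤ ελ`, `n₀² ≤ a + n₀`,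
`0 ≤ n₀ ≤ N`: `B_c a + (κ − D₀)(N − n₀) ≥ B_c N² − ελN`. [folklore] -/
theorem asm_poly {Bc κ D₀ N n0 a ε lam R : ℝ} (hBc : 0 ≤ Bc) (hn0 : 0 ≤ n0) (hn0N : n0 ≤ N)
    (hD₀ : D₀ = 2 * Bc * N) (hκ : 2 * D₀ ≤ κ) (hBε : Bc ≤ ε * lam) (hJ : n0 ^ 2 ≤ a + n0)
    (hR : Bc * a + (κ - D₀) * (N - n0) ≤ R) :
    Bc * N ^ 2 - ε * lam * N ≤ R := by
  subst hD₀
  nlinarith [mul_nonneg hBc (sq_nonneg (N - n0)), mul_nonneg hBc (sub_nonneg.2 hn0N),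
    mul_nonneg (sub_nonneg.2 hBε) (hn0.trans hn0N), mul_nonneg hBc (by linarith : 0 ≤ a + n0 - n0 ^ 2),
    mul_nonneg (by linarith : 0 ≤ κ - 2 * (2 * Bc * N)) (sub_nonneg.2 hn0N)]

/-- **Core of the assembly at fixed `(n, L, M, Φ)`**: from the landed P1, P2, P3, P5, `L³ = N/ρ`, `n ≥ 1`,
`0 < ϑ ≤ γJ/(1+γJ)` and `N ≥ 1/(2εϑ)`:
`e_ref + ϑργ(1−ε)N ≤ T + 2ργ(N − n₀) + (γ/2L³)‖PΨ‖² + ϑργ n₀` in `ℝ≥0∞`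
(peel `⊤`, then reals). [folklore] -/
theorem stub_lowerBoundCore :
    ∀ {L γ ρ ϑ ε : ℝ} {n : ℕ} (M : ℕ) (hL : 0 < L) (hγ : 0 < γ) (hρ : 0 < ρ) (hε : 0 < ε)
    (hL3 : L ^ 3 = ((n + 2 : ℕ) : ℝ) / ρ) (hn : 1 ≤ n) (hϑ : 0 < ϑ)
    (hJ : 0 ≤ bandBubble L M) (hϑJ : ϑ ≤ γ * bandBubble L M / (1 + γ * bandBubble L M))
    (hE3 : 1 / (2 * ε * ϑ) ≤ ((n + 2 : ℕ) : ℝ)) (Φ : PeriodicTrialState (n + 2) L),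
    ENNReal.ofReal (γ * ρ * ((n + 2 : ℕ) : ℝ) / (2 * (1 + γ * bandBubble L M)) +
        ϑ * (ρ * γ) * (1 - ε) * ((n + 2 : ℕ) : ℝ)) ≤
      periodicEnergy 0 Φ +
        ENNReal.ofReal (2 * ρ * γ) * (((n + 2 : ℕ) : ℝ≥0∞) - condensateOccupation (n + 2) L Φ.ψ) +
        ENNReal.ofReal (γ / (2 * L ^ 3)) * normSq L (fun Y => ∑ k ∈ momentumBand M,
          modeAn L (planeWaveMode L (-k)) (modeAn L (planeWaveMode L k) Φ.ψ) Y) +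
      ENNReal.ofReal (ϑ * (ρ * γ)) * condensateOccupation (n + 2) L Φ.ψ := by
  intro L γ ρ ϑ ε n M hL hγ hρ hε hL3 hn hϑ hJ hϑJ hE3 Φ
  /- real parameters -/
  set N : ℝ := ((n + 2 : ℕ) : ℝ) with hN_def
  set J : ℝ := bandBubble L M with hJ_def
  have hN0 : 0 < N := by rw [hN_def]; positivity
  have hNρ : N = ρ * L ^ 3 := by rw [hL3]; field_simp
  set s : ℝ := 1 / (1 + γ * J) with hs_def
  set g : ℝ := γ / L ^ 3 with hg_def
  set κ : ℝ := (2 - ϑ) * (ρ * γ) with hκ_def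
  set lam : ℝ := ϑ * (ρ * γ) with hlam_def
  set D₀ : ℝ := γ * ρ * s with hD₀_def
  set α : ℝ := D₀ / (2 * κ) with hα_def
  set w : ℝ := g * s / 2 with hw_def
  have hγJ : 0 ≤ γ * J := by positivity
  have hs0 : 0 < s := by rw [hs_def]; positivity
  have hs1 : s ≤ 1 := by rw [hs_def, div_le_one (by positivity)]; linarith
  have hϑ1 : ϑ ≤ 1 - s := by
    have : γ * J / (1 + γ * J) = 1 - s := by
      rw [hs_def]
      field_simp
      ring
    linarith [hϑJ]
  have h2ϑ : 0 < 2 - ϑ := by linarith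
  have hκ0 : 0 < κ := by rw [hκ_def]; positivity
  have hg0 : 0 < g := by rw [hg_def]; positivity
  have hD₀0 : 0 < D₀ := by rw [hD₀_def]; positivity
  have hα0 : 0 < α := by rw [hα_def]; positivity
  have hακ : 0 < α * κ := by positivity
  have h2ργ : 2 * ρ * γ = κ + lam := by rw [hκ_def, hlam_def]; ring
  have hκD : 2 * D₀ ≤ κ := by
    rw [hκ_def, hD₀_def]
    have : 2 * s ≤ 2 - ϑ := by linarith
    nlinarith only [mul_le_mul_of_nonneg_right this (by positivity : 0 ≤ ρ * γ)]
  have hBε : g * s / 2 ≤ ε * lam := by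
    have h1' : 1 ≤ N * (2 * ε * ϑ) := (div_le_iff₀ (by positivity)).1 hE3
    have e : g * s / 2 = γ * ρ * s / (2 * N) := by
      rw [hg_def, hL3]
      field_simp
    rw [e, div_le_iff₀ (by positivity), hlam_def]
    calc γ * ρ * s ≤ γ * ρ := mul_le_of_le_one_right (by positivity) hs1
      _ ≤ γ * ρ * (N * (2 * ε * ϑ)) := le_mul_of_one_le_right (by positivity) h1'
      _ = ε * (ϑ * (ρ * γ)) * (2 * N) := by ring
  /- the `ℝ≥0∞` quantities -/
  set T : ℝ≥0∞ := periodicEnergy 0 Φ with hT_def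
  set n₀ : ℝ≥0∞ := condensateOccupation (n + 2) L Φ.ψ with hn₀_def
  set A : ℝ≥0∞ := normSq L (modeAn L (planeWaveMode L 0) (modeAn L (planeWaveMode L 0) Φ.ψ)) with hA_def
  set P : ℝ≥0∞ := normSq L (fun Y => ∑ k ∈ momentumBand M,
      modeAn L (planeWaveMode L (-k)) (modeAn L (planeWaveMode L k) Φ.ψ) Y) with hP_def
  set D : ℝ≥0∞ := ((n + 2 : ℕ) : ℝ≥0∞) - n₀ with hD_def
  set nE : Momentum → ℝ≥0∞ := fun k => normSq L (modeAn L (planeWaveMode L k) Φ.ψ) with hnE_def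
  set X : Momentum → ℝ := fun k => innerRe L (modeAn L (planeWaveMode L 0) (modeAn L (planeWaveMode L 0) Φ.ψ))
      (modeAn L (planeWaveMode L (-k)) (modeAn L (planeWaveMode L k) Φ.ψ)) with hX_def
  set kk : Momentum → ℝ := fun k => ‖waveVector L k‖ ^ 2 with hkk_def
  set B : Finset Momentum := (momentumBand M).erase 0 with hB_def
  -- finiteness
  have hn₀N : n₀ ≤ ((n + 2 : ℕ) : ℝ≥0∞) := by
    rw [hn₀_def, ← cellOccupation_planeWaveMode_zero]
    exact Φ.cellOccupation_planeWaveMode_le hL 0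
  have hn₀t : n₀ ≠ ⊤ := ne_top_of_le_ne_top (ENNReal.natCast_ne_top _) hn₀N
  have hDt : D ≠ ⊤ := ENNReal.sub_ne_top (ENNReal.natCast_ne_top _)
  obtain ⟨h5a, h5b⟩ := stub_condensatePairJensen L n hL Φ
  have hAt : A ≠ ⊤ :=
    ne_top_of_le_ne_top (ENNReal.mul_ne_top (ENNReal.natCast_ne_top _) (ENNReal.natCast_ne_top _)) h5b
  obtain ⟨h3a, h3b, -⟩ := stub_bandKineticLower L γ n M hL hγ.le Φ
  have h3a' : ∑ k ∈ B, ENNReal.ofReal (kk k) * nE k ≤ T := h3a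
  have h3b' : ∑ k ∈ B, nE k ≤ D := h3b
  have hnEt : ∀ k ∈ B, nE k ≠ ⊤ := fun k hk =>
    ne_top_of_le_ne_top hDt ((Finset.single_le_sum_of_canonicallyOrdered (f := nE) hk).trans h3b')
  -- the infinite cases
  rcases eq_or_ne T ⊤ with hTt | hTt
  · rw [hTt, top_add, top_add, top_add]
    exact le_top
  rcases eq_or_ne P ⊤ with hPt | hPt
  · have : ENNReal.ofReal (γ / (2 * L ^ 3)) * P = ⊤ := by
      rw [hPt, ENNReal.mul_top (ENNReal.ofReal_pos.2 (by positivity)).ne']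
    rw [this, add_top, top_add]
    exact le_top
  /- reals -/
  set t : ℝ := T.toReal with ht_def
  set p : ℝ := P.toReal with hp_def
  set a : ℝ := A.toReal with ha_def
  set n0 : ℝ := n₀.toReal with hn0_def
  set nk : Momentum → ℝ := fun k => (nE k).toReal with hnk_def
  have hd : D.toReal = N - n0 := by
    rw [hD_def, ENNReal.toReal_sub_of_le hn₀N (ENNReal.natCast_ne_top _), ENNReal.toReal_natCast]
  have hn0_0 : 0 ≤ n0 := ENNReal.toReal_nonneg
  have hn0N : n0 ≤ N := by
    have := ENNReal.toReal_mono (ENNReal.natCast_ne_top _) hn₀N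
    rwa [ENNReal.toReal_natCast] at this
  have ha0 : 0 ≤ a := ENNReal.toReal_nonneg
  have hnk0 : ∀ k, 0 ≤ nk k := fun k => ENNReal.toReal_nonneg
  -- (R5) Jensen for the condensate pair number
  have R5 : n0 ^ 2 ≤ a + n0 := by
    have := ENNReal.toReal_mono (ENNReal.add_ne_top.2 ⟨hAt, hn₀t⟩) h5a
    rw [ENNReal.toReal_pow, ENNReal.toReal_add hAt hn₀t] at this
    exact this
  -- (R1) kinetic budget
  have R1 : ∑ k ∈ B, kk k * nk k ≤ t := by
    have h := ENNReal.toReal_mono hTt h3a'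
    rw [ENNReal.toReal_sum (fun k hk => ENNReal.mul_ne_top ENNReal.ofReal_ne_top (hnEt k hk))] at h
    refine le_trans (le_of_eq (Finset.sum_congr rfl fun k hk => ?_)) h
    rw [ENNReal.toReal_mul, ENNReal.toReal_ofReal (sq_nonneg _)]
  -- (R2) occupation budget, and its time-reversed copy
  have R2 : ∑ k ∈ B, nk k ≤ N - n0 := by
    rw [← hd, ← ENNReal.toReal_sum hnEt]
    exact ENNReal.toReal_mono hDt h3b'
  have R2' : ∑ k ∈ B, nk (-k) ≤ N - n0 :=
    (sum_band_erase_neg M nk).le.trans R2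
  -- (R3) the pair square
  have R3 : 2 * s * a ≤ p + s ^ 2 * a + max (-(2 * s * ∑ k ∈ B, X k)) 0 := by
    have h : ENNReal.ofReal (2 * s) * A ≤
        P + ENNReal.ofReal (s ^ 2) * A + ENNReal.ofReal (-(2 * s * ∑ k ∈ B, X k)) := stub_pairSquareLower L s n M hL hs0.le Φ
    have hf1 : ENNReal.ofReal (s ^ 2) * A ≠ ⊤ := ENNReal.mul_ne_top ENNReal.ofReal_ne_top hAt
    have hf2 : P + ENNReal.ofReal (s ^ 2) * A ≠ ⊤ := ENNReal.add_ne_top.2 ⟨hPt, hf1⟩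
    have h' := ENNReal.toReal_mono (ENNReal.add_ne_top.2 ⟨hf2, ENNReal.ofReal_ne_top⟩) h
    rw [ENNReal.toReal_add hf2 ENNReal.ofReal_ne_top, ENNReal.toReal_add hPt hf1] at h'
    simp only [ENNReal.toReal_mul] at h'
    rw [ENNReal.toReal_ofReal (by positivity : (0 : ℝ) ≤ 2 * s), ENNReal.toReal_ofReal (sq_nonneg s),
      ENNReal.toReal_ofReal'] at h'
    exact h'
  -- (R4) the cross terms, one band mode at a time
  have R4 : ∀ k ∈ B, max (-(2 * w * X k)) 0 ≤
      (kk k + α * κ) * nk k + w ^ 2 / (kk k + α * κ) * (N ^ 2 * nk (-k) + a) := by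
    intro k hk
    have hk0 : k ≠ 0 := (Finset.mem_erase.1 hk).1
    have hnk : -k ∈ B := Finset.mem_erase.2 ⟨neg_ne_zero.2 hk0, neg_mem_momentumBand (Finset.mem_erase.1 hk).2⟩
    have hkk0 : 0 ≤ kk k := sq_nonneg _
    have hεk : 0 < kk k + α * κ := add_pos_of_nonneg_of_pos hkk0 hακ
    have hc0 : 0 ≤ w ^ 2 / (kk k + α * κ) := by positivity
    have h : ENNReal.ofReal (-(2 * w * X k)) ≤ ENNReal.ofReal (kk k + α * κ) * nE k +
        ENNReal.ofReal (w ^ 2 / (kk k + α * κ)) * (((n + 2 : ℕ) : ℝ≥0∞) ^ 2 * nE (-k) + A) :=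
      stub_crossTermLower L (kk k + α * κ) w n k hL hεk hk0 hn Φ
    have hf1 : ENNReal.ofReal (kk k + α * κ) * nE k ≠ ⊤ := ENNReal.mul_ne_top ENNReal.ofReal_ne_top (hnEt k hk)
    have hf3 : ((n + 2 : ℕ) : ℝ≥0∞) ^ 2 * nE (-k) ≠ ⊤ :=
      ENNReal.mul_ne_top (ENNReal.pow_ne_top (ENNReal.natCast_ne_top _)) (hnEt (-k) hnk)
    have hf4 : ((n + 2 : ℕ) : ℝ≥0∞) ^ 2 * nE (-k) + A ≠ ⊤ := ENNReal.add_ne_top.2 ⟨hf3, hAt⟩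
    have hf2 : ENNReal.ofReal (w ^ 2 / (kk k + α * κ)) * (((n + 2 : ℕ) : ℝ≥0∞) ^ 2 * nE (-k) + A) ≠ ⊤ :=
      ENNReal.mul_ne_top ENNReal.ofReal_ne_top hf4
    have h' := ENNReal.toReal_mono (ENNReal.add_ne_top.2 ⟨hf1, hf2⟩) h
    rw [ENNReal.toReal_ofReal', ENNReal.toReal_add hf1 hf2] at h'
    simp only [ENNReal.toReal_mul] at h'
    rw [ENNReal.toReal_add hf3 hAt] at h'
    simp only [ENNReal.toReal_mul, ENNReal.toReal_pow, ENNReal.toReal_natCast,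
      ENNReal.toReal_ofReal hεk.le, ENNReal.toReal_ofReal hc0] at h'
    exact h'
  -- (R7) the bubble, and positivity of the band dispersion
  have R7 : ∑ k ∈ B, 1 / kk k = 2 * L ^ 3 * J := sum_inv_norm_waveVector_sq hL.ne' M
  have hkpos : ∀ k ∈ B, 0 < kk k := fun k hk => norm_waveVector_sq_pos hL.ne' (Finset.mem_erase.1 hk).1
  /- the real-variable assembly -/
  have I1 := asm_real B (fun k => -k) kk nk X (s := s) (w := w) (g := g) (a := a) (p := p) (t := t)
    (d := N - n0) (ακ := α * κ) (N := N) (C := 2 * L ^ 3 * J) hkpos hnk0 ha0 hακ hg0.le hw_def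
    R1 R2 R2' R3 R4 R7
  obtain ⟨hc1, hc2, hc3, hc4, hc5⟩ :=
    asm_consts hγ hL hJ hρ hκ0 hNρ hs_def hg_def hw_def hD₀_def hα_def
  rw [hc1, hc2] at I1
  have hD₀' : D₀ = 2 * (g * s / 2) * N := by rw [← hc3]; ring
  have hR : g * s / 2 * a + (κ - D₀) * (N - n0) ≤ t + κ * (N - n0) + g / 2 * p := by linarith only [I1]
  have I3 := asm_poly (by positivity : 0 ≤ g * s / 2) hn0_0 hn0N hD₀' hκD hBε R5 hR
  /- back to `ℝ≥0∞` -/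
  have hE2t : ENNReal.ofReal (2 * ρ * γ) * D ≠ ⊤ := ENNReal.mul_ne_top ENNReal.ofReal_ne_top hDt
  have hE3t : ENNReal.ofReal (γ / (2 * L ^ 3)) * P ≠ ⊤ := ENNReal.mul_ne_top ENNReal.ofReal_ne_top hPt
  have hE4t : ENNReal.ofReal lam * n₀ ≠ ⊤ := ENNReal.mul_ne_top ENNReal.ofReal_ne_top hn₀t
  refine ENNReal.ofReal_le_of_le_toReal ?_
  rw [ENNReal.toReal_add (ENNReal.add_ne_top.2 ⟨ENNReal.add_ne_top.2 ⟨hTt, hE2t⟩, hE3t⟩) hE4t,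
    ENNReal.toReal_add (ENNReal.add_ne_top.2 ⟨hTt, hE2t⟩) hE3t, ENNReal.toReal_add hTt hE2t]
  simp only [ENNReal.toReal_mul]
  rw [ENNReal.toReal_ofReal (by positivity : (0 : ℝ) ≤ 2 * ρ * γ),
    ENNReal.toReal_ofReal (by positivity : (0 : ℝ) ≤ γ / (2 * L ^ 3)),
    ENNReal.toReal_ofReal (by positivity : (0 : ℝ) ≤ lam), hd]
  have hsplit : 2 * ρ * γ * (N - n0) = κ * (N - n0) + lam * (N - n0) := by rw [h2ργ]; ring
  have hc5' : γ / (2 * L ^ 3) * p = g / 2 * p := by rw [hc5]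
  linarith only [I3, hsplit, hc4, hc5']

end Summit.AtomisticToContinuum.BoseEinsteinCondensation.Cruxes.RichardsonAnchorBEC.Birth

end
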